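import Mathlib
import Summits.Ventures.HodgeRepro.Tier4.Common.AdelicDefs
import Summits.Ventures.HodgeRepro.Tier4.Common.CompactOpenLevel
import Summits.Ventures.HodgeRepro.Tier4.Line1.PlaneDefs
import Summits.Ventures.HodgeRepro.Tier4.Line1.RowBasis
import Summits.Ventures.HodgeRepro.Tier4.Line1.RationalConjScalar
import Summits.Ventures.HodgeRepro.Tier4.Line1.RationalConjSystem
import Summits.Ventures.HodgeRepro.Tier4.Line1.RationalConj
import Summits.Ventures.HodgeRepro.Tier4.Line1.RealisedSetting
import Summits.Ventures.HodgeRepro.Tier4.Line1.AdelicParts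
import Summits.Ventures.HodgeRepro.Tier4.Line1.SysUniqueFinite

/-!
# Tier4/Line1/RationalConjFinite — FINITE-ADELIC J2.b: two rational points whose FINITE parts lie in one
`T(𝔸_f) × T′(𝔸_f)`-orbit are conjugate by RATIONAL elements of the tori (the algebraic core of «isolation from the
finite part alone»)

Blind re-derivation cell `pub-hodge-repro`, Tier 4 (README §9–§10), seat t4-L1-p4 (gen 4); t4-plan-1 g2's adjudication
S13794 of the self-named item S13785 (the FINITE HALF of the F2′ → (S1b) bridge, CENSUS v14 §D), names announced S13818.
Target tree path `lean/Summits/Ventures/HodgeRepro/Tier4/Line1/RationalConjFinite.lean`.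

THE STATEMENT.  For a definite, row-genuine plane, rational points `γ, γ₀` with `γ₀` linearly regular, and ADELIC torus
elements `t ∈ T(𝔸)`, `t′ ∈ T′(𝔸)` such that `t⁻¹ γ t′` and `γ₀` have the same FINITE part (entrywise `finPart`; nothing is
asked at the archimedean places), there are RATIONAL `δ ∈ T(k)`, `δ′ ∈ T′(k)` with `δ⁻¹ γ δ′ = γ₀`
(`exists_rational_conj_of_finPart`); so `γ` and `γ₀` lie in one rational double coset (`orbitOf_eq_of_finPart_conj`).
This is t4-L1-p2's `exists_rational_conj` (RationalConj p6xxxxx: the FULL adelic orbit) with the archimedean half of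
the hypothesis dropped — the half that a `K_∞`-finite archimedean test component cannot see.

THE PROOF (no port of the RationalConj chain; everything happens inside `M₄(𝔸_k) = M₄(𝔸_∞) × M₄(𝔸_f)` entrywise).
(1) As in `exists_rational_conj`: `t` acts on the row line `W₀` by an `E′_𝔸`-scalar `x + yΩ` of norm `x² + d y² = 1`
(RationalConjScalar), `S = x − yΩ` is a central unitary in both tori, and `(S t, S t′)` satisfies `P₀ (S t) = P₀`
(RationalConjSystem `adMat_P0_mul_scalar_mul`) — all on the FULL adelic `t`.
(2) UNIQUENESS over `𝔸_f` of the homogeneous rational system «`Y ∈ A_T`, `Y′ ∈ A_{T′}`, `Y Γ₀ = Γ Y′`, `P₀ Y = 0`»: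
p2's `sys_unique` applied to the MIXED adelic matrices `T̃ = (1_∞, t_f)`, `T̃′ = (1_∞, t′_f)`, `Γ̃ = (γ₀,∞, γ_f)`; its
hypotheses hold componentwise (`hΓ`: `γ_f t′_f = t_f γ₀,f` is the finite-part hypothesis, `hxy` / `hn` with
`x̃ = (1, x_f)`, `ỹ = (0, y_f)`), and an `𝔸_f`-solution `(Y_f, Y′_f)` embeds as `((0, Y_f), (0, Y′_f))`.
(3) EXISTENCE of a RATIONAL solution of the inhomogeneous system from the `𝔸_f`-solution `((S t)_f, (S t′)_f)`: a
`k`-linear retraction `φ : 𝔸_f → k` with `φ ∘ algebraMap = id` (`LinearMap.exists_leftInverse_of_injective`) applied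
entrywise preserves every equation with rational coefficients (`Matrix.map` lemmas below) — the companion of p2's
`exists_rational_of_unique` (which needs uniqueness; this needs only a nontrivial algebra).
(4) Uniqueness identifies the rational solution `(D, D′)` with `((S t)_f, (S t′)_f)`, so `D` is unitary and in the
torus over `k` (`k ↪ 𝔸_f`: `algebraMap_finiteAdele_injective`) and `D γ₀ = γ D′` over `k`; `GA.ofRationalMat` turns `D`
into a rational point.  `#print axioms` = [propext, Classical.choice, Quot.sound]; no printed input.

WHAT THIS IS NOT.  The NEIGHBOURHOOD form («every rational `γ` with `t⁻¹ γ t′ ∈ γ₀ · (K(N) × G_∞)` lies in `orbitOf γ₀`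
for `N` deep») needs the archimedean group COMPACT (F-L1-ARCH, S13818: `IsDefinite` is definiteness at ONE real place)
and is the next module, with that compactness displayed.  Nothing here is the archimedean half of the bridge.
Nothing here says anything about the status of the Hodge conjecture for CM abelian varieties, which is NOT proved
(HC_CM is NOT proved by anyone in this repository).
-/

set_option autoImplicit false

noncomputable section

namespace Summit.Ventures.HodgeRepro.Tier4.Line1

open Matrix NumberField IsDedekindDomain Summit.Ventures.HodgeRepro.Tier4.Common
open scoped NumberField

/-! ### THE THEOREM: finite-adelic J2.b -/

section Main

variable {k : Type} [Field k] [NumberField k] (W : PlaneData k)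

/-- **FINITE-ADELIC J2.b — two rational points whose FINITE parts lie in one `T(𝔸_f) × T′(𝔸_f)`-orbit are conjugate
by RATIONAL elements of the tori.**  For `t ∈ T(𝔸)`, `t′ ∈ T′(𝔸)` with `finPart (t⁻¹ γ t′) = finPart γ₀` entrywise
(nothing at the archimedean places): the scalar `x + yΩ` of `t` on `W₀` and the central unitary `S = x − yΩ` are as in
`exists_rational_conj`; the homogeneous rational system is unique over `𝔸_f` (p2's `sys_unique` on the mixed matrices
`(1_∞, t_f)`, `(γ₀,∞, γ_f)`); a `k`-linear retraction `𝔸_f → k` turns the `𝔸_f`-solution `((S t)_f, (S t′)_f)` into a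
rational one, which uniqueness identifies with it. -/
theorem exists_rational_conj_of_finPart (hW : IsDefinite W) (hg : IsGenuineRow W) (γ γ₀ : rationalPoints W)
    (hreg : IsLinRegular W γ₀) {t t' : GA W} (ht : t ∈ torusT W) (ht' : t' ∈ torusT' W)
    (h : ∀ i j, finPart k (GA.mat W (t⁻¹ * γ * t') i j) = finPart k (GA.mat W (γ₀ : GA W) i j)) :
    ∃ δ ∈ torusT W, ∃ δ' ∈ torusT' W, δ ∈ rationalPoints W ∧ δ' ∈ rationalPoints W ∧ δ⁻¹ * γ * δ' = γ₀ := by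
  obtain ⟨⟨d, hΩ, hd⟩, hΩB, -, -, hPrank, -⟩ := hg
  obtain ⟨g, hg⟩ := exists_adMat_of_rationalPoint W γ
  obtain ⟨g₀, hg₀⟩ := exists_adMat_of_rationalPoint W γ₀
  -- the matrices of `t`, `t′` and their inverses
  have hTΩ : GA.mat W t * adMat k W.Ω = adMat k W.Ω * GA.mat W t :=
    ((mem_unitaryGroup W _).1 t.2).1
  have hTB : GA.mat W t * adMat k W.B * (GA.mat W t).transpose = adMat k W.B :=
    ((mem_unitaryGroup W _).1 t.2).2
  have hTP : ∀ i, GA.mat W t * adMat k (W.P i) = adMat k (W.P i) * GA.mat W t := by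
    intro i
    fin_cases i
    · exact ht.1
    · exact ht.2
  have hT'Ω : GA.mat W t' * adMat k W.Ω = adMat k W.Ω * GA.mat W t' :=
    ((mem_unitaryGroup W _).1 t'.2).1
  have hT'Q : ∀ i, GA.mat W t' * adMat k (W.Q i) = adMat k (W.Q i) * GA.mat W t' := by
    intro i
    fin_cases i
    · exact ht'.1
    · exact ht'.2
  -- the finite-part conjugation identity `Γ_f T′_f = T_f Γ₀,f`
  have hfin : finM k (GA.mat W (t⁻¹ * γ * t')) = finM k (GA.mat W (γ₀ : GA W)) := by
    apply Matrix.ext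
    intro i j
    exact h i j
  have e1 : GA.mat W t * GA.mat W (t⁻¹ * γ * t') = adMat k g * GA.mat W t' := by
    rw [← GA.mat_mul, ← hg, ← GA.mat_mul]
    congr 1
    group
  have hΓf : finM k (adMat k g) * finM k (GA.mat W t') = finM k (GA.mat W t) * finM k (adMat k g₀) := by
    calc finM k (adMat k g) * finM k (GA.mat W t') = finM k (adMat k g * GA.mat W t') := (finM_mul _ _).symm
      _ = finM k (GA.mat W t * GA.mat W (t⁻¹ * γ * t')) := by rw [e1]
      _ = finM k (GA.mat W t) * finM k (GA.mat W (γ₀ : GA W)) := by rw [finM_mul, hfin]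
      _ = finM k (GA.mat W t) * finM k (adMat k g₀) := by rw [hg₀]
  -- the rational row vectors `w ∈ W₀`, `w₁ ∈ W₁`
  obtain ⟨v, hv⟩ := exists_vecMul_ne_zero (ne_zero_of_rank_two (hPrank 0))
  obtain ⟨v₁, hv₁⟩ := exists_vecMul_ne_zero (ne_zero_of_rank_two (hPrank 1))
  have hw : (v ᵥ* W.P 0) ᵥ* W.P 0 = v ᵥ* W.P 0 := by rw [Matrix.vecMul_vecMul, W.P_idem 0]
  have hw₁ : (v₁ ᵥ* W.P 1) ᵥ* W.P 0 = 0 := by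
    rw [Matrix.vecMul_vecMul, P1_mul_P0 W, Matrix.vecMul_zero]
  have hβ := form_self_ne_zero W hW hv
  -- the scalar action of `T` on `W₀` and its norm
  obtain ⟨x, y, hxy⟩ := exists_row_coords W hΩ hd hv hv₁ hw hw₁
    (v := (algebraMap k (Ad k) ∘ (v ᵥ* W.P 0)) ᵥ* GA.mat W t)
    (by rw [Matrix.vecMul_vecMul, hTP 0, ← Matrix.vecMul_vecMul, vecMul_adMat_algebraMap_comp, hw])
  have hn := norm_eq_one_of_unitary W hΩ hΩB hβ hTB hxy
  -- the central unitary `S = x·1 − y·Ω`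
  set S : M4 k := x • (1 : M4 k) - y • adMat k W.Ω with hS
  set Sinv : M4 k := x • (1 : M4 k) + y • adMat k W.Ω with hSinv
  have hΩΩ := adMat_Omega_mul_self W hΩ
  have hSS : S * Sinv = 1 := by
    rw [hS, hSinv]
    simp only [Matrix.sub_mul, Matrix.mul_add, Matrix.smul_mul, Matrix.mul_smul, Matrix.one_mul,
      Matrix.mul_one, hΩΩ]
    trans (x * x + algebraMap k (Ad k) d * (y * y)) • (1 : M4 k)
    · module
    · rw [hn, one_smul]
  have hSS' : Sinv * S = 1 := by
    rw [hS, hSinv]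
    simp only [Matrix.add_mul, Matrix.mul_sub, Matrix.smul_mul, Matrix.mul_smul, Matrix.one_mul,
      Matrix.mul_one, hΩΩ]
    trans (x * x + algebraMap k (Ad k) d * (y * y)) • (1 : M4 k)
    · module
    · rw [hn, one_smul]
  have hScomm : ∀ M : M4 k, M * adMat k W.Ω = adMat k W.Ω * M → M * S = S * M := by
    intro M hM
    have := scalar_comm W hM x (-y)
    simpa [hS, sub_eq_add_neg, neg_smul] using this
  have hSΩ : S * adMat k W.Ω = adMat k W.Ω * S := (hScomm _ rfl).symm
  have hSB : S * adMat k W.B * S.transpose = adMat k W.B := scalar_mul_B_mul_transpose W hΩ hΩB hn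
  let Sgl : GL4 k := ⟨S, Sinv, hSS, hSS'⟩
  have hSmem : Sgl ∈ unitaryGroup W := ⟨hSΩ, hSB⟩
  let s : GA W := ⟨Sgl, hSmem⟩
  have hs_mat : GA.mat W s = S := rfl
  have hsT : s ∈ torusT W := by
    refine ⟨?_, ?_⟩
    · change S * adMat k (W.P 0) = adMat k (W.P 0) * S
      exact (hScomm _ (by rw [← adMat_mul, ← adMat_mul, W.P_comm 0])).symm
    · change S * adMat k (W.P 1) = adMat k (W.P 1) * S
      exact (hScomm _ (by rw [← adMat_mul, ← adMat_mul, W.P_comm 1])).symm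
  have hsT' : s ∈ torusT' W := by
    refine ⟨?_, ?_⟩
    · change S * adMat k (W.Q 0) = adMat k (W.Q 0) * S
      exact (hScomm _ (by rw [← adMat_mul, ← adMat_mul, W.Q_comm 0])).symm
    · change S * adMat k (W.Q 1) = adMat k (W.Q 1) * S
      exact (hScomm _ (by rw [← adMat_mul, ← adMat_mul, W.Q_comm 1])).symm
  have hSP : ∀ i, S * adMat k (W.P i) = adMat k (W.P i) * S := by
    intro i
    fin_cases i
    · exact hsT.1
    · exact hsT.2
  have hSQ : ∀ i, S * adMat k (W.Q i) = adMat k (W.Q i) * S := by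
    intro i
    fin_cases i
    · exact hsT'.1
    · exact hsT'.2
  have hΓΩ : adMat k g * adMat k W.Ω = adMat k W.Ω * adMat k g := by
    rw [← hg]
    exact ((mem_unitaryGroup W _).1 (γ : GA W).2).1
  have hSΓ : S * adMat k g = adMat k g * S := (hScomm _ hΓΩ).symm
  -- UNIQUENESS of the homogeneous rational system over `𝔸_f` (SysUniqueFinite)
  have hreg' : ∀ Z Z' : M4 k, Z * adMat k W.Ω = adMat k W.Ω * Z →
      (∀ i, Z * adMat k (W.P i) = adMat k (W.P i) * Z) → Z' * adMat k W.Ω = adMat k W.Ω * Z' →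
      (∀ i, Z' * adMat k (W.Q i) = adMat k (W.Q i) * Z') → Z * adMat k g₀ = adMat k g₀ * Z' →
      ∃ x y : Ad k, Z = x • (1 : M4 k) + y • adMat k W.Ω ∧ Z' = x • (1 : M4 k) + y • adMat k W.Ω := by
    intro Z Z' a b c e f
    refine hreg Z Z' a b c e ?_
    rw [hg₀]
    exact f
  have huniq := fun (Yf Y'f : Matrix (Fin 4) (Fin 4) (FiniteAdeleRing (𝓞 k) k)) =>
    sys_unique_finPart W hΩ hd hv hv₁ hw hw₁ ht ht' hΓf hreg' hxy hn (Yf := Yf) (Y'f := Y'f)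
  -- THE `𝔸_f`-SOLUTION `((S t)_f, (S t′)_f)` of the inhomogeneous system
  have hXΩ : finM k (S * GA.mat W t) * W.Ω.map (algebraMap k (FiniteAdeleRing (𝓞 k) k)) =
      W.Ω.map (algebraMap k (FiniteAdeleRing (𝓞 k) k)) * finM k (S * GA.mat W t) := by
    rw [← finM_adMat, ← finM_mul, ← finM_mul, Matrix.mul_assoc, hTΩ, ← Matrix.mul_assoc, hSΩ, Matrix.mul_assoc]
  have hXP : ∀ i, finM k (S * GA.mat W t) * (W.P i).map (algebraMap k (FiniteAdeleRing (𝓞 k) k)) =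
      (W.P i).map (algebraMap k (FiniteAdeleRing (𝓞 k) k)) * finM k (S * GA.mat W t) := fun i => by
    rw [← finM_adMat, ← finM_mul, ← finM_mul, Matrix.mul_assoc, hTP i, ← Matrix.mul_assoc, hSP i,
      Matrix.mul_assoc]
  have hX'Ω : finM k (S * GA.mat W t') * W.Ω.map (algebraMap k (FiniteAdeleRing (𝓞 k) k)) =
      W.Ω.map (algebraMap k (FiniteAdeleRing (𝓞 k) k)) * finM k (S * GA.mat W t') := by
    rw [← finM_adMat, ← finM_mul, ← finM_mul, Matrix.mul_assoc, hT'Ω, ← Matrix.mul_assoc, hSΩ,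
      Matrix.mul_assoc]
  have hX'Q : ∀ i, finM k (S * GA.mat W t') * (W.Q i).map (algebraMap k (FiniteAdeleRing (𝓞 k) k)) =
      (W.Q i).map (algebraMap k (FiniteAdeleRing (𝓞 k) k)) * finM k (S * GA.mat W t') := fun i => by
    rw [← finM_adMat, ← finM_mul, ← finM_mul, Matrix.mul_assoc, hT'Q i, ← Matrix.mul_assoc, hSQ i,
      Matrix.mul_assoc]
  have hXΓ : finM k (S * GA.mat W t) * g₀.map (algebraMap k (FiniteAdeleRing (𝓞 k) k)) =
      g.map (algebraMap k (FiniteAdeleRing (𝓞 k) k)) * finM k (S * GA.mat W t') := by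
    calc finM k (S * GA.mat W t) * g₀.map (algebraMap k (FiniteAdeleRing (𝓞 k) k))
        = finM k S * (finM k (GA.mat W t) * finM k (adMat k g₀)) := by
          rw [finM_adMat, finM_mul, Matrix.mul_assoc]
      _ = finM k S * (finM k (adMat k g) * finM k (GA.mat W t')) := by rw [hΓf]
      _ = finM k (S * adMat k g) * finM k (GA.mat W t') := by rw [finM_mul, Matrix.mul_assoc]
      _ = finM k (adMat k g * S) * finM k (GA.mat W t') := by rw [hSΓ]
      _ = g.map (algebraMap k (FiniteAdeleRing (𝓞 k) k)) * finM k (S * GA.mat W t') := by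
          rw [finM_mul, finM_mul, Matrix.mul_assoc, finM_adMat]
  have hP0X : (W.P 0).map (algebraMap k (FiniteAdeleRing (𝓞 k) k)) * finM k (S * GA.mat W t) =
      (W.P 0).map (algebraMap k (FiniteAdeleRing (𝓞 k) k)) := by
    rw [← finM_adMat, ← finM_mul]
    congr 1
    exact adMat_P0_mul_scalar_mul W hΩ hd hv hv₁ hw hw₁ hTΩ hxy hn
  -- the RATIONAL solution through the retraction
  obtain ⟨φ, hφ⟩ := exists_retraction_finiteAdele (k := k)
  have hDΩ : (finM k (S * GA.mat W t)).map φ * W.Ω = W.Ω * (finM k (S * GA.mat W t)).map φ := by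
    rw [← map_mul_algMat φ, ← algMat_mul_map φ, hXΩ]
  have hDP : ∀ i, (finM k (S * GA.mat W t)).map φ * W.P i = W.P i * (finM k (S * GA.mat W t)).map φ :=
    fun i => by rw [← map_mul_algMat φ, ← algMat_mul_map φ, hXP i]
  have hD'Ω : (finM k (S * GA.mat W t')).map φ * W.Ω = W.Ω * (finM k (S * GA.mat W t')).map φ := by
    rw [← map_mul_algMat φ, ← algMat_mul_map φ, hX'Ω]
  have hD'Q : ∀ i, (finM k (S * GA.mat W t')).map φ * W.Q i = W.Q i * (finM k (S * GA.mat W t')).map φ :=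
    fun i => by rw [← map_mul_algMat φ, ← algMat_mul_map φ, hX'Q i]
  have hDΓ : (finM k (S * GA.mat W t)).map φ * g₀ = g * (finM k (S * GA.mat W t')).map φ := by
    rw [← map_mul_algMat φ, ← algMat_mul_map φ, hXΓ]
  have hP0D : W.P 0 * (finM k (S * GA.mat W t)).map φ = W.P 0 := by
    rw [← algMat_mul_map φ, hP0X, map_algMat_map φ hφ]
  -- uniqueness identifies the rational solution with the `𝔸_f`-solution
  have hDX : ((finM k (S * GA.mat W t)).map φ).map (algebraMap k (FiniteAdeleRing (𝓞 k) k)) =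
        finM k (S * GA.mat W t) ∧
      ((finM k (S * GA.mat W t')).map φ).map (algebraMap k (FiniteAdeleRing (𝓞 k) k)) =
        finM k (S * GA.mat W t') := by
    have key := huniq
      (((finM k (S * GA.mat W t)).map φ).map (algebraMap k (FiniteAdeleRing (𝓞 k) k)) - finM k (S * GA.mat W t))
      (((finM k (S * GA.mat W t')).map φ).map (algebraMap k (FiniteAdeleRing (𝓞 k) k)) -
        finM k (S * GA.mat W t'))
      (by rw [Matrix.sub_mul, Matrix.mul_sub, hXΩ, ← Matrix.map_mul, hDΩ, Matrix.map_mul])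
      (fun i => by rw [Matrix.sub_mul, Matrix.mul_sub, hXP i, ← Matrix.map_mul, hDP i, Matrix.map_mul])
      (by rw [Matrix.sub_mul, Matrix.mul_sub, hX'Ω, ← Matrix.map_mul, hD'Ω, Matrix.map_mul])
      (fun i => by rw [Matrix.sub_mul, Matrix.mul_sub, hX'Q i, ← Matrix.map_mul, hD'Q i, Matrix.map_mul])
      (by rw [Matrix.sub_mul, Matrix.mul_sub, hXΓ, ← Matrix.map_mul, hDΓ, Matrix.map_mul])
      (by rw [Matrix.mul_sub, hP0X, ← Matrix.map_mul, hP0D, sub_self])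
    exact ⟨sub_eq_zero.1 key.1, sub_eq_zero.1 key.2⟩
  -- the rational solution is unitary
  have hstB : S * GA.mat W t * adMat k W.B * (S * GA.mat W t)ᵀ = adMat k W.B :=
    ((mem_unitaryGroup W _).1 (s * t).2).2
  have hst'B : S * GA.mat W t' * adMat k W.B * (S * GA.mat W t')ᵀ = adMat k W.B :=
    ((mem_unitaryGroup W _).1 (s * t').2).2
  have hDB : (finM k (S * GA.mat W t)).map φ * W.B * ((finM k (S * GA.mat W t)).map φ)ᵀ = W.B := by
    apply Matrix.map_injective (algebraMap_finiteAdele_injective (k := k))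
    show (_ : Matrix (Fin 4) (Fin 4) k).map (algebraMap k (FiniteAdeleRing (𝓞 k) k)) =
      W.B.map (algebraMap k (FiniteAdeleRing (𝓞 k) k))
    rw [Matrix.map_mul, Matrix.map_mul, Matrix.transpose_map, hDX.1, ← finM_adMat, ← finM_transpose,
      ← finM_mul, ← finM_mul, hstB]
  have hD'B : (finM k (S * GA.mat W t')).map φ * W.B * ((finM k (S * GA.mat W t')).map φ)ᵀ = W.B := by
    apply Matrix.map_injective (algebraMap_finiteAdele_injective (k := k))
    show (_ : Matrix (Fin 4) (Fin 4) k).map (algebraMap k (FiniteAdeleRing (𝓞 k) k)) =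
      W.B.map (algebraMap k (FiniteAdeleRing (𝓞 k) k))
    rw [Matrix.map_mul, Matrix.map_mul, Matrix.transpose_map, hDX.2, ← finM_adMat, ← finM_transpose,
      ← finM_mul, ← finM_mul, hst'B]
  have hdet := det_ne_zero_of_form W hW hDB
  have hdet' := det_ne_zero_of_form W hW hD'B
  -- the rational points
  refine ⟨GA.ofRationalMat W _ hdet hDΩ hDB, ⟨?_, ?_⟩, GA.ofRationalMat W _ hdet' hD'Ω hD'B, ⟨?_, ?_⟩,
    GA.ofRationalMat_mem_rationalPoints W _ hdet hDΩ hDB, GA.ofRationalMat_mem_rationalPoints W _ hdet' hD'Ω hD'B,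
    ?_⟩
  · change GA.mat W (GA.ofRationalMat W _ hdet hDΩ hDB) * adMat k (W.P 0) =
      adMat k (W.P 0) * GA.mat W (GA.ofRationalMat W _ hdet hDΩ hDB)
    rw [GA.mat_ofRationalMat, ← adMat_mul, ← adMat_mul, hDP 0]
  · change GA.mat W (GA.ofRationalMat W _ hdet hDΩ hDB) * adMat k (W.P 1) =
      adMat k (W.P 1) * GA.mat W (GA.ofRationalMat W _ hdet hDΩ hDB)
    rw [GA.mat_ofRationalMat, ← adMat_mul, ← adMat_mul, hDP 1]
  · change GA.mat W (GA.ofRationalMat W _ hdet' hD'Ω hD'B) * adMat k (W.Q 0) =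
      adMat k (W.Q 0) * GA.mat W (GA.ofRationalMat W _ hdet' hD'Ω hD'B)
    rw [GA.mat_ofRationalMat, ← adMat_mul, ← adMat_mul, hD'Q 0]
  · change GA.mat W (GA.ofRationalMat W _ hdet' hD'Ω hD'B) * adMat k (W.Q 1) =
      adMat k (W.Q 1) * GA.mat W (GA.ofRationalMat W _ hdet' hD'Ω hD'B)
    rw [GA.mat_ofRationalMat, ← adMat_mul, ← adMat_mul, hD'Q 1]
  · -- the conjugation identity
    have hconj : GA.ofRationalMat W _ hdet hDΩ hDB * (γ₀ : GA W) =
        (γ : GA W) * GA.ofRationalMat W _ hdet' hD'Ω hD'B := by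
      apply Subtype.ext
      apply Units.ext
      change GA.mat W (GA.ofRationalMat W _ hdet hDΩ hDB) * GA.mat W (γ₀ : GA W) =
        GA.mat W (γ : GA W) * GA.mat W (GA.ofRationalMat W _ hdet' hD'Ω hD'B)
      rw [GA.mat_ofRationalMat, GA.mat_ofRationalMat, hg, hg₀, ← adMat_mul, ← adMat_mul, hDΓ]
    calc (GA.ofRationalMat W _ hdet hDΩ hDB)⁻¹ * (γ : GA W) * GA.ofRationalMat W _ hdet' hD'Ω hD'B
        = (GA.ofRationalMat W _ hdet hDΩ hDB)⁻¹ * ((γ : GA W) * GA.ofRationalMat W _ hdet' hD'Ω hD'B) :=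
          mul_assoc _ _ _
      _ = (GA.ofRationalMat W _ hdet hDΩ hDB)⁻¹ * (GA.ofRationalMat W _ hdet hDΩ hDB * (γ₀ : GA W)) := by
          rw [hconj]
      _ = γ₀ := inv_mul_cancel_left _ _

end Main

/-! ### The double-coset form on the instance -/

section Instance

open MeasureTheory

variable {k : Type} [Field k] [NumberField k] (W : PlaneData k) [MeasurableSpace (GA W)] [BorelSpace (GA W)]

/-- **Finite-adelic J2.b on `Setting.ofAdelic`**: two rational points whose FINITE parts lie in one adelic
`T × T′`-orbit lie in one rational double coset — `orbitOf_eq_of_conj` (RealisedSetting) on the rational conjugators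
of `exists_rational_conj_of_finPart`. -/
theorem orbitOf_eq_of_finPart_conj (hW : IsDefinite W) (hg : IsGenuineRow W) (R : RTFData W) (μ : Measure (GA W))
    [μ.IsHaarMeasure] [R.μT.IsHaarMeasure] [R.μT'.IsHaarMeasure] (hT : IsCompact (closure R.DT))
    (hT' : IsCompact (closure R.DT')) (γ γ₀ : rationalPoints W) (hreg : IsLinRegular W γ₀) {t t' : GA W}
    (ht : t ∈ torusT W) (ht' : t' ∈ torusT' W)
    (h : ∀ i j, finPart k (GA.mat W (t⁻¹ * γ * t') i j) = finPart k (GA.mat W (γ₀ : GA W) i j)) :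
    (Setting.ofAdelic W hW hg R μ hT hT').orbitOf γ = (Setting.ofAdelic W hW hg R μ hT hT').orbitOf γ₀ := by
  obtain ⟨δ, hδ, δ', hδ', -, -, hconj⟩ := exists_rational_conj_of_finPart W hW hg γ γ₀ hreg ht ht' h
  exact orbitOf_eq_of_conj W hW hg R μ hT hT' γ γ₀ hreg ⟨δ, hδ, δ', hδ', hconj⟩

end Instance

end Summit.Ventures.HodgeRepro.Tier4.Line1

end
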